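import Summits.QuantumFields.YangMills.Theorems.VirialFluxGapFixFrame
import Summits.QuantumFields.YangMills.Theorems.VirialFluxGapFixDimCount
import HarnessLib

/-!
# Route `VirialFluxGap` (YangMills): the DIMENSION COUNT of the `X_fix` frame — `#ι = 18L⁴ + 3`

The load-bearing count of the generic chart on `X_fix` (LEAD ruling 2026-08-30T23:30Z, fcl-p3's count check 2026-08-31T00:19Z) for the
⟨stmt-QuantumFields-24141⟩ `PeriodicSoftness` team: with `m = 4` exact kernel vectors (✓`FixFrame.exists_four_orthonormal_kernel_vectors`)
the divergence bound of ✓`FrameHessian.generic_divergence_upper` is `½(#ι − m) + (small)`, and «EulerFieldFix» (✓`periodicSoftness_of_eulerFieldFix`)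
needs `Σ Dφ ≤ 18L⁴ − 2c₁` with SOME `c₁ > 0` — so the EXACT value `#ι = 3·#FixVar L = 18L⁴ + 3` (margin exactly `1` before the small terms)
matters; `#FixVar L = #OffIdx + (2L−1)·3L³ + L³ = 6L⁴ + 1` by w3's ✓`FixSplit.card_offIdx` (`#OffIdx = 2L³ + 1`, the comb tree has `L³ − 1`
links) and ✓`card_edge_three`.

* `card_fixVar` — `Fintype.card (FixVar L) = 6L⁴ + 1`; ★ `card_fixVar_mul_three` — `Fintype.card (FixVar L × Fin 3) = 18L⁴ + 3`, and the
  real-cast form `card_fixVar_mul_three_real` used in the estimates.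

HONEST FRAMING: arithmetic bookkeeping; ⟨24141⟩ and ⟨22884⟩ stay OPEN; no stub ∕ crux ∕ rung ∕ summit is closed; the Yang–Mills mass gap is NOT
proved; no summit is proved by a line.  No definitions, 0 `sorry`, standard axioms.  Width seat `ym-line-sfw-p2-w2` g51 (cell ym-idea-1, free
hands), `--supports stmt-QuantumFields-24141`.  References: [folklore].
-/

set_option autoImplicit false

namespace Summit.QuantumFields.YangMills.Theorems.VirialFluxGap.FixFrame

open Literature.MathematicalPhysics.QuantumFieldTheory hiding SU2
open Literature.MathematicalPhysics.QuantumLattice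
open Summit.QuantumFields.YangMills.Theorems.FemtoTransferGap
open Summit.QuantumFields.YangMills.Theorems.FemtoTransferGap.TT
open Summit.QuantumFields.YangMills.Theorems.VirialFluxGap.FixSplit

variable {L : ℕ} [NeZero L]

/-- `#FixVar L = #OffIdx + (2L−1)·#Edge + #Site = 6L⁴ + 1`. [folklore] -/
theorem card_fixVar : Fintype.card (FixVar L) = 6 * L ^ 4 + 1 := by
  have hL : 1 ≤ L := NeZero.one_le
  have hS : Fintype.card (Site 3 L) = L ^ 3 := by
    rw [Fintype.card_pi, Finset.prod_const, Finset.card_univ, Fintype.card_fin, ZMod.card]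
  rw [Fintype.card_sum, Fintype.card_sum, Fintype.card_prod, Fintype.card_fin, card_offIdx, FemtoTransferGap.card_edge_three L, hS]
  obtain ⟨M, rfl⟩ : ∃ M, L = M + 1 := ⟨L - 1, by omega⟩
  rw [show 2 * (M + 1) - 1 = 2 * M + 1 by omega]
  ring

/-- ★ The number of frame coordinates of `X_fix`: `#(FixVar L × Fin 3) = 18L⁴ + 3`. [folklore] -/
theorem card_fixVar_mul_three : Fintype.card (FixVar L × Fin 3) = 18 * L ^ 4 + 3 := by
  rw [Fintype.card_prod, Fintype.card_fin, card_fixVar]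
  ring

/-- The same count in `ℝ` (the `Fintype.card ι` of ✓`generic_divergence_upper` ∕ ✓`trace_resolvent_le` for `ι = FixVar L × Fin 3`). [folklore] -/
theorem card_fixVar_mul_three_real : (Fintype.card (FixVar L × Fin 3) : ℝ) = 18 * (L : ℝ) ^ 4 + 3 := by
  rw [card_fixVar_mul_three]
  push_cast
  ring

/-- With `m = 4` kernel vectors the generic divergence margin is exactly one below `18L⁴`: `#ι − 4 = 18L⁴ − 1`. [folklore] -/
theorem card_fixVar_mul_three_sub_four_real : (Fintype.card (FixVar L × Fin 3) : ℝ) - 4 = 18 * (L : ℝ) ^ 4 - 1 := by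
  rw [card_fixVar_mul_three_real]
  ring

end Summit.QuantumFields.YangMills.Theorems.VirialFluxGap.FixFrame
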